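import Mathlib
import Literature.MathematicalPhysics.QuantumFieldTheory.Balaban1983to89.B10Assembly
import Literature.MathematicalPhysics.QuantumFieldTheory.Balaban1983to89.B10SectAStatements
import Literature.MathematicalPhysics.QuantumFieldTheory.Balaban1983to89.B10SectCExpansion

/-!
# `Balaban1983to89.B10Carve31Thm1SectsABHyp` — [Balaban1985UV3] pp. 255–266 [PDF 1–12] (Introduction (1)–(6) and
# Theorem 1 p. 257; Sect. A «A Discussion of the First Renormalization Transformation» (7)–(37) pp. 257–265; Sect. B
# «An Inductive Assumption on the Form of Approximate Effective Actions» (38)–(43) p. 266): THE HYPOTHESIS-FORM BUNDLE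
# OF CARVING BLOCK 31 — the block's printed statements conjoined BY NAME from the tree over the carriers of record
# (`B10.TowerRun`, `B10SectAGathering.StepPieces`, `B10.PolymerActivities`, `B10SectCExpansion.VertexGeometry`,
# `B10LargeField.DomainSeq`, `B10SectAStatements.FirstStep`), with the kernel-checked delivery of (36)–(37) and of the
# family-level Theorem 1 slots, and a non-vacuity witness

statement-level skeleton of published theorems with citation tags; proofs where landed; nothing here is a claim about the Yang–Mills mass gap

SOURCE.  T. Bałaban, *Ultraviolet stability of three-dimensional lattice pure gauge field theories*, Commun. Math. Phys.
**102** (1985) 255–275, doi:10.1007/bf01229380 [Balaban1985UV3] (cell paper "B10"; held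
`paper:balaban1985-cmp102-uv-stability-3d`, journal page = PDF page + 254).  Pages 256–266 were read first-hand for this
file on the page renders `run/shared/lean/pub/pub-balaban/b2b-balaban-ref1/pages/1985-cmp102-uv-stability-3d/…-p002-x2.png`
… `…-p012-x2.png` (the text layer `p0002.txt`–`p0012.txt` garbles every display; locators `pNNNN.txt:L<n>` below are lines
of that text layer, NNNN = PDF page); p. 255 = title, abstract and the first paragraphs of the introduction (no statement).
d = 3 THROUGHOUT (cell DIVERGENCE D-r2.1).  Where print refers to «[4]» = [Balaban1985Averaging] (cell B7), «[5]» =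
[Balaban1985BackgroundPropagators] (B9), «[6]» = [Balaban1985RegularSpaces] (B8), «[7]» = [Balaban1985Variational] (B11),
«[8]–[10]» = the (Higgs)₂,₃ papers, «[19]» = Gawędzki–Kupiainen, the pointer is recorded and nothing of those papers is
restated.

WHY THIS FILE (cell `lit-balaban`, P6 CARVING FAN of D-0154 (3b); seat `lit-balaban-carve-05` (gen 5) holding BLOCK 31
under lead RULING #7 (5) ∕ RULING #8 of `run/shared/lean/pub/lit-balaban/carve/STATUS.md`; block row 31 of
`carve/BLOCKS-31-40.md` v1.3 ∕ `carve/CARVE-LIST.md`, rules `carve/CARVE-RULES.md`; KEY item `stmt-QuantumFields-20542`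
(K1⁷ `StabilityBAtRecordR13SepCoPH`, DAG lane n08 [B10] → n13), also-feeds `stmt-QuantumFields-20544`, `-19936`
((7) p. 257), `-20520` ((14) ∕ (19))).  At statement level this stretch of [B10] is IN THE TREE (cell SKELETON v3.365: 38 rows,
typed-existing 17, proved 13, proved-existing 4, typed 4; 2355 declarations in 262 files carry a locator in pp. 255–266), so by
the fan's rule «IN TREE = CITE, NEVER RESTATE» this file (a) restates nothing — every printed item of the block that has a
declaration is cited BY NAME (tables §A, §B); (b) types the block's printed PARAMETER RANGES and the two remark-level
printed statements that have no declaration (`ParamsPrinted`: «p₀ > 2» p. 257, «κ₁ = 1/7κ» p. 264, …; `Degree264Printed`: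
«polynomials in B … at most the sixth order» p. 264 — §B says why these and only these); (c) conjoins the block's printed
statements BY NAME into ONE hypothesis bundle `Hyp` for ONE lattice approximation (one run `T : B10.TowerRun`, the carrier of
rows B10.Eq2 ∕ B10.Eq41), which a node prover takes as `(h : Hyp …)`; (d) kernel-checks the bookkeeping a consumer wants:
the Sect. A conclusion (36)–(37) = `B10.FirstStep36_37Printed T` DELIVERED from the slots through the tree's own
one-level-down resolution `B10SectAGathering.firstStep36_37_of_leaves` (`Hyp.firstStep36_37`, `Hyp.ineq41_47_one`), the
p. 265 counterterm recursion «E₁ = E − E^{(0)}» (`E1_eq`), the family-level readings of Theorem 1 from the per-run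
(5)-slots (`thm1Printed_of_forall`, `thm1Printed_of_bounded`, `thm1Compact_of_forall` — the uniformity clause «O(1) is
independent of ε, k, g_k in a bounded set» made explicit as "one constant serves all runs iff the per-run constants are
bounded"), NON-DEGENERACY (`not_hyp_of_rho_gt`, `not_hyp_of_p₀_le_two`) and NON-VACUITY (§5: the bundle holds on the
tree's trivial run `B10Assembly.trivRun K`, every K ≥ 1).  It moves no node count; Theorem 1 of [B10] is NOT proved here
(it is a slot), and nothing about the Yang–Mills mass gap is claimed.

## §A  The block's SKELETON rows → the in-tree declarations this file CITES (never restates)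
(module prefix `Literature.MathematicalPhysics.QuantumFieldTheory.Balaban1983to89.`; «slot» = enters `Hyp` by name; «delivered» = proved from `Hyp`)

| row | print (journal page) | in tree | here |
|---|---|---|---|
| B10.Eq1 | (1) p. 256 «ρ₀(U) = exp[−(1/g₀²)A(U) − E]» | `B10.Step0Printed` ((41)₀ ∧ (47)₀), `B10LargeField.NoInteraction0`; the density tower `B10Eq2DensityTower.towerPrintedSU2 ∕ SUN ∕ SUNFree` | slots `step0`, `noInt0` |
| B10.Eq2 | (2) «ρ_{k+1} = Tρ_k» | carrier `B10.RunData` ∕ `B10.TowerRun` (`ρ k`); `B10Eq2DensityTower`, `B10Eq2HaarCompatibility` | the carrier `T` |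
| B10.Eq3 | (3)–(4) p. 256, «with a constant O(1) depending on g and ε₀ only … The constant O(1) goes to ∞ as g → 0» | `B10Ineq3Terminal` ((3) from (5) at k = K), `B10Eq5RegularAction`, `B10.RunData.χ` ((4)) | cited |
| B10.Eq4 | (4) «|U(∂p) − 1| < ε₁, p ⊂ T₁^{(K)}» | `B10.RunData.χ`; SKELETON cite `B14Eq218Concrete.Data218.χ` | cited |
| B10.Eq5 | (5) p. 256 + p. 257 l. 1 «and the constant O(1) is independent of ε, k, g_k in a bounded set» | `B10.Bounds5`, `B10.Bounds5At`, `B10.gRun`, `B10.sitesRun` («g_k = g(L^kε)^{1/2}, |T₁^{(k)}| = … = (L^kε)^{−3}|T_ε|») | slots `thm1`, `scaling` |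
| B10.Thm1 | Theorem 1 p. 257 | `B10.Thm1Printed` (verbatim, one constant per bounded coupling set), `B10.Thm1PrintedCompact` (cell audit reading G-B10-01), `B10CompactBinding.ofPrintedAllXPNC`, `B10RunsOfRecord.PrintedUV3 ∕ PrintedUV3G`, `Node00.PrintedUV3V ∕ V'`, `T3ContinuumYM3Torus.UV3StabilityPrinted`; DAG `Dag.B10_main`, `DagBinding.b10`; against the leaves `B10Assembly.thm1Compact_and_thm2_of_leafSystem`, `B10DagLeaf` | family theorems §4 from the per-run slot `thm1` |
| B10.Eq6 | (6) p. 257 «∫dUρ_k = ∫dUT^kρ₀ = ∫dUρ₀ = Z^ε» | `B10.partition_upper`, `B10Eq6PartitionLower`, `B10Eq6DensityLevel`; `B10.Step.integral_RT_eq` (SKELETON cite `Step.integral_RT_eq`) | cited |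
| B10.Eq7 | (7) p. 257 + «ε₁ = g₀p(g₀), p(g) = b₀(1 + log g⁻¹)^{p₀}, p₀ > 2 … R = R₁(1 + log g₀⁻¹)^{r₀} = R₁r(g₀)» | `B10Decomposition7.term7`, `B10.pFun`, `B10.rFun` (bodies) | `ParamsPrinted` («p₀ > 2» typed here — §B) |
| B10.Eq8 | (8) p. 258 «1 = Σ_{admissible Ω₁} ζ_{Ω₁ᶜ}χ_{Ω₁}» | `B10Decomposition7.chiDom` (+ «at least one corner», «The meaning of ζ_{Ω₁ᶜ} is clear») | cited |
| B10.Eq9 | (9)–(10) p. 258 (Faddeev–Popov, axial gauge) | `Beta.TreeGaugeFP.measurePreserving_mul_inv_pi` (PROVED; «fixed to 1 at points of the new lattice» also `B10Eq27AxialLog`) | cited |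
| B10.Eq11 | (11) p. 258 «smaller than any positive power of ε» | PROVED `B10.smallFactor_le_pow`; the trace identity `B10Eq11Trace.eq11_normalized` | cited |
| B10.Eq12 | (12) pp. 258–259 + «exactly one critical configuration U₁ … |U₁(∂p) − 1| < 2B₃g₀p(g₀) on Ω₁» | `B10SectAStatements.Eq12` over `B10SectAStatements.FirstStep` ∕ `B11.VarProblem`; the p. 258 Prop. 1 [4] clause `B10.edge_B7Prop1_twoLsq`, `B10Eq13RegularityClaims.claim258` | slot `eq12` |
| — | (13) p. 259 (+ «Lemma 1 [6] with α₀ = 2L²B₃g₀p(g₀), α₁ = 0 … |V′ − 1| < 8·3²L²B₃g₀p(g₀)», «We enlarge the region … |A′| < 16·3²L²B₃g₀p(g₀)», «we have put U′ = 1, U₁ = V₀ on Ω₁ᶜ») | `B10.edge_B8Lemma1_alpha1_zero`, `B10Eq13RegularityClaims.claim259 ∕ claim259_d3 ∕ lemma1_alpha1_zero`, `B10Eq13Enlargement.region_subset_enlarged` | cited (inside the leaf (22)) |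
| — | (14)–(16) p. 259, (18)–(21) pp. 260–261 (Haar density σ, |Ω₁*|, minimum at A = 0, Ṽ₀ from third order, det and σ∕σ₀ exponentiated) | `B10Eq18ChangeOfVariables`, `B10Eq18SigmaSU2Haar` («σ(A) = 1/2π²(sin|A|/|A|)²»; (16), «The constant σ₀ will be discussed later»), `B10Eq18SigmaEven ∕ SigmaEvenSuN` («analytic, positive, even … invariant»), `B10StarCount` (|Ω₁*|), PROVED `B10Eq19LinearTerm.minimum_at_zero ∕ linearTerm_vanishes ∕ linear_term_absent_19`, `B10Eq19ThirdOrder.eq17Local_tildeV0_analyticAt`, PROVED `B10Assembly.eq20_det_blockTriangular`, `B10Eq20Locality.det_one_sub_eq_prod`, PROVED `B10Assembly.eq21_prod_eq_exp_sum_log`, `B10Eq22Rescaling.eq21 ∕ haar_density_split ∕ finrank_ker_eq_dg_mul_star` | cited (inside the leaf (22)) |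
| B10.Eq17 | (17) p. 260 «unique solution D̃ … analytic … Taylor expansion beginning with second order terms», «D̃(A, b, c) = 0 for all b ≠ b₀(c)», «depends on A restricted to B(c₋) ∪ B(c₊)» | `B10SectAStatements.Eq17`, the local reading `B10Eq17LocalSolution.Eq17Local` (and `not_eq17_sqCt` there), `B10Eq17LocalTorus`, `B10Eq17RecursiveSystem`, `B13PkLocalTerms.fpMap` | cited, deliberately NOT a slot (five generic type ∕ operator parameters with typeclass binders; a consumer takes `Eq17Local` itself) |
| B10.Eq20, B10.Eq21 | (20), (21) p. 261 | PROVED `B10Eq20Locality.eq20_exp_sum_log`, `B10Eq22Rescaling.eq21` | cited |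
| B10.Eq22 | (22) p. 261 | leaf `B10SectAGathering.Bound55` at k = 0 (its docstring quotes (22)); SKELETON cite `B10SectAGathering.Bound55`; the rescaling `B10Eq22Rescaling` | slots `bound22`, `bound22Lower` (p. 265 lower remark) |
| B10.Eq23 | (23) p. 262 «(3.108) [5]» | `B10Eq25Rate.WalkTermBound23`, `B10Eq25WalkGeometry(Torus)`, `B10Eq25TubeLaw`, `B10Eq24GraphTerms` («at most eight legs … at most six vertices» also `B10Eq24Cumulant`) | cited |
| B10.Eq24 | (24) p. 262 + «O(g₀⁷p¹⁸(g₀))|Ω₁| ≤ O(ε^{3+κ₀})|T₁|, κ₀ > 0» | leaf `B10SectAGathering.Cumulant58` (k = 0, Cz = 0), raw form `B10Assembly.Cumulant58Raw` + PROVED `B10Assembly.cumulant58_of_raw`, `B10SectAGathering.remainder_powerCounting`; `B10Eq24Cumulant.FluctuationModel.LocalizationUpper` | slots `cumulant24`, `cumulant37`, `rem_eq` |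
| B10.Eq25 | (25) p. 262 «where κ can be arbitrarily large if M₁ is sufficiently large» + the three properties p. 263 | `B10.Bound25Printed` over `B10.PolymerActivities`; (26) `B10Eq26MeasureInv.rot`, `B10Eq26SiteGauge`, `B10Eq26SuSlice`, `B10Eq26TubeIdentity`; localization ∕ analyticity `B10Eq28RegularTube`, `B10Eq28CplxRegTube`; the M₁-dependence of κ `B10Eq25TubeLaw`, `B10Eq65PolymerSum` | slot `bound25` |
| B10.Eq26–B10.Eq32 | (26)–(32) pp. 263–264 | `B10Eq26MeasureInv.rot`, `B10Eq27AxialLog.contour27 ∕ B27 ∕ norm_B27_le ∕ eq28_print` («This bound, with a different absolute constant, extends to the whole configuration B», «similar bound for 𝓗(B), with the additional constant B₃» there and `B10Eq28RegularTube`), `B10Eq27TorusAxialLog`, `B10Eq29TubeLine.expLine`, `B10Eq29CplxLine`, (30) `B10Eq61Leaves.expChart` + PROVED `B10SectAGathering.remainder30_le`, `B10Eq31GlobalConj.conjCfg`, `B10Eq32SuN ∕ AxialSuN ∕ RegularSuN` («(26) holds for all regular gauge field configurations»), PROVED `B10.invariant_vector_eq_zero` ((31) ⇒ (32)); the Sect.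 F [7] inputs «𝓗(B) = HB + A₁ … Eq. (158) [7]» = `B11.SectFPrinted`, `B11.Prop9Printed` | cited |
| B10.Eq33, B10.Eq34 | (33)–(34) p. 264 | leaf `B10SectAGathering.Repr33_60` (raw `B10Assembly.Repr33_60Raw`), the per-term shape `B10SectCExpansion.Shape43` (its docstring quotes (34) as the first-step case) | slots `repr33`, `shape34`; «at most the sixth order» typed here (`Degree264Printed`, slot `degree34`) |
| B10.Eq35 | (35) p. 265 + the p. 265 paragraph (vacuum sum «bounded by O(g₀)|Ω₁ᶜ|», «supplement also the constants», decomposition of log Z) | leaves `B10SectAGathering.Norm35`, `.VacuumWhole`, `.StarCount`, `.Decomp35_61`; model `B10Eq35Norm.Norm35Model` | slots `norm35`, `vacuum265`, `starCount`, `decomp265` |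
| B10.Eq36, B10.Eq37 | (36)–(37) p. 265 «where g₁ = g(Lε)^{1/2}, E₁ = E − E^{(0)}, and E^{(0)} = …» | `B10.FirstStep36_37Printed`; leaves `B10SectAGathering.PintSucc`, `.Estep62`, `.ZtermSucc`, `.RmSucc`; PROVED `B10SectAGathering.firstStep36_37_of_leaves` | slots `pint36`, `estep36`, `zterm36`, `rm36`; `B10.FirstStep36_37Printed` DELIVERED (`Hyp.firstStep36_37`); «E₁ = E − E^{(0)}» PROVED (`E1_eq`) |
| B10.Eq38, B10.Eq39, B10.Eq40 | (38)–(40) p. 266 + «blocks with distances to P ∪ Ω₁ᶜ greater than RM₁, where R = R₁r(g₁)» | `B10LargeField.DomainSeq`, `.Nested38`, `.Sep39`, `.Rule268`, `.Chi40`, `.Z`, `.Λ`; on the torus of record `B10Eq38TorusDomains.collarPrinted ∕ Sep39Printed ∕ zetaPrinted`, `B10Eq39CollarVolume`; SKELETON cites `B10LargeField.DomainSeq ∕ Sep39 ∕ Λ` | slots `nested38`, `sep39`, `collar39`, `rule266`; (40) cited |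
| B10.Eq41 | (41) p. 266 «Our inductive assumption has the following form» | `B10.Ineq41` (+ `B10.Ineq47`, `B10.SpecOK`), `T3AlphaInputsAC.Ineq41At ∕ Ineq41AE`, `B10Eq41TorusHistories` | slot `spec` (the form); (41) ∧ (47) at k = 1 DELIVERED (`Hyp.ineq41_47_one`); for every k it is Theorem 2 p. 272 (block 32: `B10.Thm2Printed`) |
| B10.Eq42 | (42) p. 266 «it is a minimum of the functional … where we have put Λ₀ = Ω₁ᶜ and V_k = V» | `B10NestedMinimizer.LevelMin`, `B10Eq42TorusConstraint`; the carrier's `B10.TowerRun.mainT` | cited |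
| B10.Eq43 | (43) p. 266 | `B10SectCExpansion.Shape43` (general scale, ℓ = Lʲη), `B10SectCExpansion.Bound44 ∕ 45` (block 32) | cited; its first-step case (34) is the slot `shape34` |
| B10.Eq38-1.12 | (38)–(42) ↔ the d = 4 large-field decomposition | Summits-side `LargeFieldDecomp` (SKELETON cite `Setup.lean:648`; not importable into `Literature/`) | cited |

## §B  Census of the REMAINING printed sentences of pp. 256–266 that assert or define something, with disposition
(every quote read on the page render; nothing below is typed anew unless marked TYPED HERE)

* p. 256 (p0002.txt:L12–18) «It is convenient to assume that all the lattices T^{(k)} are unit lattices … We terminate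
  constructions of the densities ρ_k when we reach the unit lattice, or more exactly when L^kε = ε₀, where ε₀ is a positive
  constant depending on the coupling constant g only. Let us denote by K the index satisfying this equality, i.e. L^Kε = ε₀.»
  — `ParamsPrinted.ε₀_pos` and the slot `Hyp.terminal` (`L ^ T.K * ε = ε₀`); the cell's reading «ε₀ ≤ 1» is
  `B10Assembly.LeafSystem.scale_le_one` (not repeated: print states no inequality).
* p. 257 (p0003.txt:L8–10) «The above theorem can be generalized to a much wider class of compact Lie groups … We have
  restricted ourselves to semi-simple groups because then the proof is particularly simple.» — remark, quoted in
  `B10Eq18SigmaEvenSuN`; nothing to type.  (p0003.txt:L15–16) «we concentrate mainly on the proof of the upper bound» — `B10`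
  module docstring.
* p. 257 (p0003.txt:L33–38) «p₀ > 2 and b₀ is a sufficiently large absolute constant … blocks of the size M₁ … R = R₁(1 +
  log g₀⁻¹)^{r₀} = R₁r(g₀)» — TYPED HERE as RANGES in `ParamsPrinted` («p₀ > 2»: the tree had only `0 < p₀`,
  `B10Assembly.Consts.p₀_pos`; «sufficiently large» b₀ has no printed threshold — positivity only, the thresholds being
  consumed where they are located: `B10.smallFactor_le_pow` (b₀² ≥ N), `B10LargeField.balance_threshold`; r₀ is free in
  print — cell GAPS G-B10-02).
* p. 258 (p0004.txt) «where χ_{Ω₁} involves the characteristic functions in (7) connected with plaquettes p ∈ Ω₁, i.e.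
  plaquettes with at least one corner belonging to Ω₁» — `B10Decomposition7.chiDom`; «If a configuration U belongs to this
  region, then it satisfies the regularity conditions |U(∂p) − 1| < g₀p(g₀) on the domain Ω₀, and by Proposition 1 from [4]
  the configuration V = Ū satisfies the conditions |V(∂p′) − 1| < 2L²g₀p(g₀) on Ω₀^{(1)}» — PROVED edge `B10.edge_B7Prop1_twoLsq`,
  `B10Eq13RegularityClaims.claim258`: cited.
* p. 259 (p0005.txt:L1–6) «For g₀ sufficiently small 2L²g₀p(g₀) < a₁ … Such a space contains the region of integration, so
  there is at most one critical point in the region» — inside `B10SectAStatements.Eq12` (slot); «for g₀ sufficiently small»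
  (also p. 260 L33, p. 263 L29) — slot `Hyp.g0_le_one`, the cell's reading of the unprinted threshold
  (`B10Assembly.LeafSystem.g_le_one`): what the bookkeeping uses is `0 < g₀ ≤ 1` (log g₀⁻¹ ≥ 0).
* p. 259 (p0005.txt) «(14) … where the second equality follows from the definition (89) (or (63)) in [4], and the gauge fixing
  conditions. Properties of the function Q(A′) = Q(U₁, A′) were described in Proposition 3 [4]. It is an analytic function of A′
  with the decomposition (15) Q(A′) = QA′ + C(A′) … C(A′) is an analytic function with an expansion beginning with a second
  order polynomial … The constant σ₀ will be discussed later» — provenance by reference to [4] (= B7: `B7.Prop3Printed`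
  lineage) and the data `(C̃, h, b₀)` of `B13PkLocalTerms.fpMap` ∕ `B10Eq17LocalTorus`; σ₀ in `B10Eq18SigmaSU2Haar`: cited.
* p. 260 (p0006.txt) «Generally σ(A) is an analytic, positive, even function of A in a neighbourhood of 0 ∈ 𝔤, invariant with
  respect to the adjoint representation» — PROVED for the classical groups in `B10Eq18SigmaEven ∕ SigmaEvenSuN`,
  `HaarDensityEvenClosedSubgroup`: cited.  «The function in the exponential … has a minimum at A = 0. This implies that a linear
  term in its expansion vanishes … J = D*_{U₁} Im U₁ … D*_{U₁}D_{U₁} + (a small perturbation)» — `B10Eq19LinearTerm`: cited.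
* p. 261 (p0007.txt) «Ṽ₀(A) … is an analytic function of A with an expansion beginning with third order terms, and it is a sum
  over plaquette variables of functions which are almost local in A and U₁» — `B10Eq19ThirdOrder`; «in the exponential the sum
  is over almost local functions» — `B10Eq20Locality`; «dμ is a Gaussian measure with a covariance having an exponential decay
  property (… Sect. E in [5])» — `B9.Thm312Printed` lineage (block 10), `B10Eq65PolymerSum`: cited.
* p. 262 (p0008.txt:L2–9, L23–28) the cumulant-expansion narrative, «They have at most eight legs, and the graphs have at most
  six vertices», «the factor exp(−R), which is smaller than arbitrary power of ε … we get O(ε^κ)|T₁|» — `B10Eq24Cumulant`,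
  `B10Eq24GraphTerms`, PROVED `B10Assembly.largeLoc_le_rpow`: cited; (p0008.txt:L33–38) the definition of 𝓛(X) after [19] —
  `B10.PolymerActivities.ℒ`, `B10Eq25WalkGeometry`: cited.
* p. 263 (p0009.txt:L4–12) the three properties of 𝒫′₁ and the mechanism of (26) — `B10Eq26MeasureInv` &c. (table); (L13–26)
  «We may assume that X̃⁵ ⊂ □ also, and a center of □ belongs to X … there exists a gauge transformation in a neighbourhood of
  □₁ … represented as exp i𝓗(B) … 𝓗(B) = HB + A₁» — `B10Eq27AxialLog` (quoted; Sect. F of [7] = `B11.SectFPrinted`): cited.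
* p. 264 (p0010.txt:L12–14) «The function 𝓗(B) = HB + A₁ is determined by the solution A₁ of Eq. (158) [7], and this solution
  is an analytic function of HB, or B.» — by reference to [7] (= `B11.Prop9Printed`, analytic extension, p. 309); the tree's
  analytic line through a complex background is `B10Eq29CplxLine`, `B10Eq28CplxRegTube`: cited, not a statement of this paper.
* p. 264 (p0010.txt:L18–20) «Thus we obtain expressions which are polynomials in B of at least the second order, and at most
  the sixth order, localized in □₁.» — the FLOOR «at least the second order» is the first clause of `B10SectCExpansion.Shape43`
  (slot `shape34`); the CEILING «at most the sixth order» has no declaration — TYPED HERE: `Degree264Printed`, slot `degree34`.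
* p. 264 (p0010.txt:L20–25) «For each variable B(c) there is a sequence of propagators connecting the bond c with the set X.
  They provide the exponential factor exp(−δ₀dist(c, X)). This together with the exponential factor on the right-hand side of
  (25) give the factor exp(−κ₁M₁⁻¹|c₋ − y|), with κ₁ = 1/7κ. We use the remaining exp(−κ₁𝓛(X)) to control a sum over all X
  contributing to a given monomial in variables B.» — the mechanism is quoted in `B10Assembly.Repr33_60Raw`; the RELATION
  BETWEEN THE CONSTANTS of (25) and (34) ∕ (43), «κ₁ = 1/7κ», has no declaration (the tree's `κ₁` of `Shape43 ∕ Bound44` is a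
  free parameter) — TYPED HERE: `ParamsPrinted.κ₁_eq`.
* p. 264 (p0010.txt:L32–34) «the expressions 𝒫₁(g₀, Y, U₁) behave like irrelevant variables as they are at least second power
  in loop variables B₁» — remark; `B10.Bound46Printed` docstring, PROVED `B10.powerCounting_d3`: cited.
* p. 265 (p0011.txt:L14–17) «we get an expression Σ_Y𝒫₁(Y, U₁) which is identical to the expression on the right-hand side of
  (33), only the coefficients do not depend on g₀. This expansion we analyse in the general case later» —
  `B10SectAGathering.Decomp35_61` (slot), (63) pp. 271–272 `B10LogDet63` (block 32): cited.  (L21–23) «This inequality is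
  the basis of our inductive assumption in the next section» — `Hyp.ineq41_47_one` below.
* p. 266 (p0012.txt:L12–14, L23–27) «We define the sets Λ_j, 𝔅 as in [5] … Z_j = Ω_{j+1}^{(j)c} … functions ζ_{Λ_j} are
  defined in the same way as ζ_{Ω₁ᶜ}», «Here the sets Z_j are rescaled to the unit scale», «The configuration U_k is
  determined by the variational problem considered in [7]», «A definition of E_k is clear from (36), and will be discussed
  later also» — `B10LargeField.Z ∕ Λ`, `B10Eq38TorusDomains`, `B10NestedMinimizer`, `B10Eq42TorusConstraint`, (64) p. 273
  `B10.Ek` (block 32): cited.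

## §C  Design of the bundle (what is a slot, what is cited only, and why)

One run `T : B10.TowerRun` (one lattice approximation: torus T_ε, spacing ε, K steps) because Sect. A and Sect. B speak of
one run; Theorem 1's uniformity over runs is the business of the family theorems of §4, which quantify `∀ i, Hyp c (ε i) …
(T i) …` with ONE record `c : Consts` of family constants (the printed «absolute constant(s)» and O(·)'s) exactly as
`B10Assembly.LeafSystem C (T i)` does with `B10Assembly.Consts`.  The Theorem-1 slot is the per-run display (5),
`B10.Bounds5 T.toRunData O1`, with the run's constant `O1` a PARAMETER (not a family constant): so the family conjunction
with a common `O1` is print's «independent of ε, k» (⇒ `B10.Thm1Printed`, `thm1Printed_of_forall`), while a window-dependent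
`O1` is the cell's audit reading `B10.Thm1PrintedCompact` (GAPS G-B10-01; `thm1Compact_of_forall`) — the file takes no side
and restates neither.  Sect. A is carried by the tree's step-0 pieces `P : B10SectAGathering.StepPieces T 0` (whose leaves
QUOTE (22), (24), (33), (35), (36), (37) at k = 0), (25) by `B10.PolymerActivities`, (34) by `B10SectCExpansion.VertexGeometry`,
(12) by `B10SectAStatements.FirstStep`, Sect. B by `B10LargeField.DomainSeq`.  CITED ONLY (deliberately not slots): (7)–(11),
(13)–(16), (18)–(21), (23), (26)–(32) — proof narrative inside the leaf (22) resp. PROVED theorems or model objects on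
foreign carriers (table §A); (17) — generic operator data (see the row); (40), (42) — definitions of χ_j and of U_k, named by
the carrier (`T.χ`, `T.mainT`); (43) at general scale — block 32's `Bound44 ∕ 45` consume it, its first-step case (34) is the
slot.  No `instance`, no `notation`, no `sorry`; every hypothesis is an explicit structure field or binder.
-/

noncomputable section

namespace Literature.MathematicalPhysics.QuantumFieldTheory.Balaban1983to89.B10Carve31Thm1SectsABHyp

open Literature.MathematicalPhysics.QuantumFieldTheory.Balaban1983to89.B10
  (TowerRun RunData pFun rFun gRun sitesRun Bounds5 Bounds5At Step0Printed FirstStep36_37Printed Ineq41 Ineq47 SpecOK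
    PolymerActivities Bound25Printed Thm1Printed Thm1PrintedCompact)
open Literature.MathematicalPhysics.QuantumFieldTheory.Balaban1983to89.B10SectAGathering
  (StepPieces StepLeaves Bound55 Bound55Lower Cumulant58 CumulantLower Repr33_60 VacuumWhole Decomp35_61 Norm35 StarCount
    OldOutside PintSucc Estep62 ZtermSucc RmSucc)
open Literature.MathematicalPhysics.QuantumFieldTheory.Balaban1983to89.B10LargeField
  (DomainSeq Nested38 Sep39 Rule268 NoInteraction0)
open Literature.MathematicalPhysics.QuantumFieldTheory.Balaban1983to89.B10SectCExpansion
  (VertexGeometry TermSizes Shape43)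

/-! ## §1  The family constants named by the block's printed sentences, and their printed RANGES -/

/-- **The constants of pp. 256–266 that are common to all lattice approximations of one model** — the printed «absolute
constant(s)» and the values at which the printed O(·)'s of Sect. A are taken (print: O(·) «independent of ε», p. 257 l. 1),
one record per family exactly as `B10Assembly.Consts` (whose Sect. C ∕ D entries `C46, z, aP, rstar, d` belong to block 32 and
are not repeated here).  Every field names a printed symbol or a printed O(·) (locators in the field docstrings); only NAMES
constants, asserts nothing. [cite: Balaban1985UV3, pp.256–257 + (24)–(25) p.262 + (33)–(34) p.264 + (35)–(37) p.265] -/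
structure Consts where
  /-- (1) p. 256: the bare coupling `g` («g₀² = g²ε^{4−d} = g²ε (d = 3)»; p. 256 «g_k = g(L^kε)^{1/2}») -/
  g : ℝ
  /-- (2) p. 256: the block size `L` of the renormalization transformation `T` «described in [1, 4]» (`T^{(k)}_{L^kε}`) -/
  L : ℝ
  /-- p. 256: «L^kε = ε₀, where ε₀ is a positive constant depending on the coupling constant g only» -/
  ε₀ : ℝ
  /-- p. 257: the big-block size `M₁` («big blocks, i.e. blocks of the size M₁, of the unit lattice T₁») -/
  M₁ : ℝ
  /-- p. 257: `p(g) = b₀(1 + log g⁻¹)^{p₀}`, «b₀ is a sufficiently large absolute constant» (`B10.pFun b₀ p₀`) -/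
  b₀ : ℝ
  /-- p. 257: the exponent `p₀` of `p(g)`, «p₀ > 2» -/
  p₀ : ℝ
  /-- p. 257: «We take R = R₁(1 + log g₀⁻¹)^{r₀} = R₁r(g₀)»; (39) p. 266 «R(g_j) = R₁r(g_j)» (`B10.rFun r₀`) -/
  R₁ : ℝ
  /-- p. 257: the exponent `r₀` of `r(g)` (no printed range — cell GAPS G-B10-02) -/
  r₀ : ℝ
  /-- p. 262: the remainder exponent, «O(ε^{3+κ₀})|T₁|, κ₀ > 0» -/
  κ₀ : ℝ
  /-- (25) p. 262: the tree-decay rate `κ` of «O(g₀)e^{−κ𝓛(X)}» («κ can be arbitrarily large if M₁ is sufficiently large») -/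
  κ : ℝ
  /-- (25) p. 262: the constant of «O(g₀)» in «|𝒫′₁(g₀, X, U₁)| ≤ O(g₀)e^{−κ𝓛(X)}» -/
  C₂₅ : ℝ
  /-- (34) p. 264 ∕ (43) p. 266: the decay rate `κ₁` of «exp(−κ₁M₁⁻¹|c_{i,−} − y|)», p. 264 «with κ₁ = 1/7κ» -/
  κ₁ : ℝ
  /-- (34) p. 264: the constant of «O(g₀)» in «|𝒫₁(g₀, Y)| ≤ O(g₀) Π_{i=1}^n exp(−κ₁M₁⁻¹|c_{i,−} − y|)» -/
  C₃₄ : ℝ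
  /-- (24) p. 262: the constant of the cumulant remainder «+ O(ε^{3+κ₀})|T₁|» -/
  C₂₄ : ℝ
  /-- (37) p. 265: the constant of the same remainder in the lower bound «− O(ε^{3+κ₀})|T₁|» -/
  C₃₇ : ℝ
  /-- (33) p. 264: the constant of the representation remainder «+ O(ε^{3+κ₀})|T₁|» -/
  C₃₃ : ℝ
  /-- p. 265: the constant of «This sum can be bounded by O(g₀)|Ω₁ᶜ|» (the whole-lattice vacuum sum) -/
  Cv : ℝ
  /-- p. 262: the large localizations excluded from (24), «we get O(ε^κ)|T₁|», inside the vacuum sum -/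
  Cv' : ℝ
  /-- (35) p. 265: the O(1) of «|log (Z^{(0)}(Ω₁, 1)/Z^{(0)}(T₁, 1))| ≤ O(1)|Ω₁ᶜ|» -/
  C₃₅ : ℝ
  /-- p. 265: the remainder of «The term log Z^{(0)}(Ω₁, U₁) − log Z^{(0)}(Ω₁, 1) can be decomposed in a similar way as the
  integral in (24)» -/
  Cd : ℝ
  /-- p. 265: the count behind «We have to supplement also the constants in (22), involving log σ₀ and log g₀, to the whole
  lattice» (unprinted count, cell GAPS G-B10-07 (a); `B10SectAGathering.StarCount`) -/
  c₁ : ℝ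

/-- **The printed RANGES of the parameters** (one field each, verbatim where print gives one): p. 256 [2] «g₀² = g²ε^{4−d} =
g²ε» (a coupling and a lattice spacing: `0 < g`, `0 < ε`; «|T_ε| = Σ_{x∈T_ε} ε³» ≥ 0), (2) with [1, 4] (the block size of
`T`, `1 < L` — the cell's standing reading, `B10Assembly.Consts.one_lt_L`), «ε₀ is a positive constant depending on the
coupling constant g only»; p. 257 [3] (p0003.txt:L33–38) «p(g) = b₀(1 + log g⁻¹)^{p₀}, p₀ > 2 and b₀ is a sufficiently large
absolute constant … blocks of the size M₁ … We take R = R₁(1 + log g₀⁻¹)^{r₀} = R₁r(g₀)» (`2 < p₀`; for b₀, M₁, R₁ print gives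
no threshold — positivity only, the located thresholds being consumed where they live, e.g. `B10.smallFactor_le_pow`,
`B10LargeField.balance_threshold`; r₀ carries no printed range, cell GAPS G-B10-02); p. 262 [8] (p0008.txt:L2) «O(ε^{3+κ₀})|T₁|,
κ₀ > 0»; (25) p. 262 «e^{−κ𝓛(X)}, where κ can be arbitrarily large if M₁ is sufficiently large» (`0 < κ`); p. 264 [10]
(p0010.txt:L23) «with κ₁ = 1/7κ» — the relation between the decay rates of (25) and of (34) ∕ (43), typed here for the first
time (`κ₁_eq`), READ as `κ₁ = κ/7` (one seventh of κ: the decay `e^{−κ𝓛(X)}` of (25) is shared among the at most six loop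
variables of a monomial and «the remaining exp(−κ₁𝓛(X))»; the in-line print «1/7κ» is typographically ambiguous and this is
the reading the sentence forces).  A `Prop`-valued record of hypotheses; nothing is asserted. [cite: Balaban1985UV3, p.256 + p.257 + p.262 + p.264] -/
structure ParamsPrinted (c : Consts) (ε Tε : ℝ) : Prop where
  g_pos : 0 < c.g
  one_lt_L : 1 < c.L
  ε_pos : 0 < ε
  Tε_nonneg : 0 ≤ Tε
  ε₀_pos : 0 < c.ε₀
  M₁_pos : 0 < c.M₁
  b₀_pos : 0 < c.b₀
  two_lt_p₀ : 2 < c.p₀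
  R₁_pos : 0 < c.R₁
  κ₀_pos : 0 < c.κ₀
  κ_pos : 0 < c.κ
  κ₁_eq : c.κ₁ = c.κ / 7

namespace ParamsPrinted

variable {c : Consts} {ε Tε : ℝ}

/-- `0 < p₀` (the weaker range the tree used so far, `B10Assembly.Consts.p₀_pos`) from the printed «p₀ > 2». [cite: Balaban1985UV3, p.257 (bookkeeping)] -/
theorem p₀_pos (h : ParamsPrinted c ε Tε) : 0 < c.p₀ := lt_trans (by norm_num) h.two_lt_p₀

/-- `0 < L` (from the block size reading `1 < L`). [cite: Balaban1985UV3, (2) p.256 (bookkeeping)] -/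
theorem L_pos (h : ParamsPrinted c ε Tε) : 0 < c.L := lt_trans one_pos h.one_lt_L

/-- `0 < κ₁ = κ/7`. [cite: Balaban1985UV3, p.264 (bookkeeping)] -/
theorem κ₁_pos (h : ParamsPrinted c ε Tε) : 0 < c.κ₁ := by rw [h.κ₁_eq]; exact div_pos h.κ_pos (by norm_num)

/-- `0 < g_k = g(L^kε)^{1/2}` for the printed scaling (`B10.gRun_pos`). [cite: Balaban1985UV3, (5) p.256 (bookkeeping)] -/
theorem gRun_pos (h : ParamsPrinted c ε Tε) (k : ℕ) : 0 < gRun c.g c.L ε k :=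
  B10.gRun_pos c.g c.L ε h.g_pos h.L_pos h.ε_pos k

end ParamsPrinted

/-! ## §2  The one remark-level printed statement of the block with no declaration: the degree CEILING of p. 264 -/

/-- **p. 264 [10] (p0010.txt:L18–20)**, verbatim: *«Thus we obtain expressions which are polynomials in B of at least the
second order, and at most the sixth order, localized in □₁.»* — the monomials `⟨𝒫₁(g₀, Y), B₁(c₁), …, B₁(c_n)⟩` of (34) have
`2 ≤ n ≤ 6` (the floor is (34)'s «n ≥ 2», the first clause of `B10SectCExpansion.Shape43`; the ceiling comes from the
sixth-order truncation (30) and is NOT carried by `Shape43`).  Typed over the same coefficient-size family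
`P : B10SectCExpansion.TermSizes X` as `Shape43` ((34) ∕ (43): `P y n c = |𝒫₁(g₀, Y)|`, `Y = (y, c₁, …, c_n)`): a non-zero
coefficient has at most six loop variables.  Hypothesis-shaped (printed proof: the expansion (30) p. 263 «it is enough to
expand up to the sixth order» + p. 264 «We expand it up to the sixth order at most»). [cite: Balaban1985UV3, p.264] -/
def Degree264Printed (X : VertexGeometry) (P : TermSizes X) : Prop :=
  ∀ (y : X.Site) (n : ℕ) (c : Fin n → X.Bond), P y n c ≠ 0 → n ≤ 6

/-- (34) + p. 264 together: a non-zero coefficient has `2 ≤ n ≤ 6` loop variables (`Shape43`'s floor and `Degree264Printed`'s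
ceiling). [cite: Balaban1985UV3, (34) p.264 (bookkeeping)] -/
theorem degree_window_of_shape34 {X : VertexGeometry} {P : TermSizes X} {κ₁ M₁ ℓ C : ℝ} (h34 : Shape43 X P κ₁ M₁ ℓ C)
    (h6 : Degree264Printed X P) (y : X.Site) (n : ℕ) (c : Fin n → X.Bond) (hP : P y n c ≠ 0) : 2 ≤ n ∧ n ≤ 6 :=
  ⟨h34.1 y n c hP, h6 y n c hP⟩

/-! ## §3  THE BUNDLE -/

/-- **BLOCK 31 HYPOTHESIS BUNDLE — the printed statements of [B10] pp. 256–266 for ONE lattice approximation, conjoined BY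
NAME.**  Carriers: `T : B10.TowerRun` (one run: «the sequence of densities ρ_k», (2), with the shape of (41) ∕ (47));
`P : B10SectAGathering.StepPieces T 0` (the named pieces of the FIRST renormalization step, Sect. A); `S12` (the variational
problem (12)); `A` (the localization expansion of (24)–(25)); `X, P34` (the loop-variable monomials of (33)–(34)); `D` (the
domains of Sect. B); the run's data `ε` (spacing), `Tε = |T_ε|`, and `O1` = the constant of (5) for this run; `c` the family
constants.  Fields, in page order:
* `params` — the printed ranges (`ParamsPrinted`);
* `scaling` — p. 256 [2] after (5): *«g_k = g(L^kε)^{1/2}, |T₁^{(k)}| = Σ_{y∈T₁^{(k)}} 1 = Σ_{x∈T_η} η³ = (L^kε)^{−3}|T_ε|»*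
  (bodies `B10.gRun`, `B10.sitesRun`); `terminal` — p. 256 *«L^Kε = ε₀»*;
* `step0`, `noInt0`, `rm0` — **(1)** p. 256 *«ρ₀(U) = exp[−(1/g₀²)A(U) − E]»* as (41)₀ ∧ (47)₀ with no interaction
  terms and no remainder term (`B10.Step0Printed`, `B10LargeField.NoInteraction0`; the carrier's `Rm 0`, cf.
  `B10Assembly.LeafSystem.Rm_zero`);
* `spec` — Sect. B p. 266 [12] *«In this section we formulate inequalities satisfied by all the actions ρ_k, k = 1, 2, …, K.
  … Our inductive assumption has the following form (41)»* with (47) p. 267: the inductive inequalities asserted of this run's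
  densities (`RunData.Ineq41_47`, Theorem 2's predicate) ARE (41) ∧ (47) (`B10.SpecOK`);
* `thm1` — **Theorem 1** p. 257 [3], verbatim: *«The lattice approximations of the three-dimensional pure Yang–Mills theory
  with a semi-simple compact group Lie G are ultraviolet stable in the sense that the sequence of densities ρ_k, constructed by
  the inductive definition (2), with ρ₀ given by (1), satisfies the bounds (5).»*, (5) p. 256: *«χ(U)exp[−(1/g_k²)A^η(U_k(U)) −
  O(1)|T₁^{(k)}|] ≤ ρ_k(U) ≤ exp O(1)|T₁^{(k)}|»* — FOR THIS RUN with constant `O1` (`B10.Bounds5`); the uniformity clause p. 257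
  l. 1 *«and the constant O(1) is independent of ε, k, g_k in a bounded set»* is the family level, §4;
* `g0_le_one` — *«for g₀ sufficiently small»* (p. 259 l. 1, p. 260, p. 263), in the cell's reading `g₀ ≤ 1`
  (`B10Assembly.LeafSystem.g_le_one`; print states no threshold; `0 < g₀` follows from `scaling`);
* `eq12` — **(12)** pp. 258–259 with its two printed consequences (`B10SectAStatements.Eq12`), at this run's `g₀, L, b₀, p₀`;
* `bound22`, `bound22Lower` — **(22)** p. 261 and the p. 265 lower-bound remark (`B10SectAGathering.Bound55 ∕ Bound55Lower` at
  k = 0); `rem_eq` — p. 262 the remainder unit *«O(ε^{3+κ₀})|T₁|»*;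
* `cumulant24`, `cumulant37` — **(24)** p. 262 (no `|Ω₁ᶜ|`-term at the first step: `Cz = 0`) and its (37)-direction
  (`Cumulant58`, `CumulantLower`);
* `bound25` — **(25)** p. 262 *«|𝒫′₁(g₀, X, U₁)| ≤ O(g₀)e^{−κ𝓛(X)}»* (`B10.Bound25Printed` at `g₀ = T.g 0`);
* `shape34`, `degree34` — **(34)** p. 264 *«n ≥ 2 … |𝒫₁(g₀, Y)| ≤ O(g₀) Π_{i=1}^n exp(−κ₁M₁⁻¹|c_{i,−} − y|)»*
  (`B10SectCExpansion.Shape43` at unit scale `ℓ = 1`, constant `C₃₄·g₀`) and p. 264 «at most the sixth order»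
  (`Degree264Printed`);
* `repr33` — **(33)** p. 264 (`Repr33_60`); `vacuum265` — p. 265 *«This sum can be bounded by O(g₀)|Ω₁ᶜ|»* (`VacuumWhole`);
  `norm35` — **(35)** p. 265 (`Norm35`); `decomp265` — p. 265 the decomposition of `log Z^{(0)}(Ω₁, U₁) − log Z^{(0)}(Ω₁, 1)`
  (`Decomp35_61`); `starCount` — p. 265 *«We have to supplement also the constants in (22) … to the whole lattice»*
  (`StarCount`, the count print omits — flagged in the tree, GAPS G-B10-07 (a));
* `noOld0` — (22) ∕ (36) carry no previous-scale interaction terms at the first step (the term lists of the two displays);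
  `pint36`, `estep36` — **(36)** p. 265: *«+ Σ_Y𝒫₁(g₀, Y, U₁)»* and *«E^{(0)} = log σ₀|T₁*| + d(𝔤) log g₀|T₁*| + log Z^{(0)}(T₁, 1)
  + Σ_X𝒫′₁(g₀, X, 1)»* (`PintSucc`, `Estep62` at k = 0); `zterm36`, `rm36` — (36) ∕ (37)'s *«+ O(log g₀⁻¹)|Ω₁ᶜ|»* and
  *«± O(ε^{3+κ₀})|T₁|»* taken at least as large as the gathered constants (`ZtermSucc`, `RmSucc` — the tree's explicit reading
  of the two printed O(·)'s, `B10SectAGathering.StepLeaves`);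
* `nested38`, `sep39`, `collar39`, `rule266` — **(38)** *«Ω₁ ⊃ Ω₂ ⊃ ⋯ ⊃ Ω_k, Ω_j ⊂ T_η»*, **(39)** *«(Lʲη)⁻¹dist(Ω_jᶜ, Ω_{j+1}) >
  R(g_j)M₁, R(g_j) = R₁r(g_j)»* and p. 266 l. 5–7 *«we take blocks with distances to P ∪ Ω₁ᶜ greater than RM₁, where R =
  R₁r(g₁)»* (`B10LargeField.Nested38`, `.Sep39`, the collar `R(g_j)M₁` with `B10.rFun`, `.Rule268`).
Only conjoins named hypotheses; an instance built from the true densities (1)–(2) is what the audit of the series is about.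
[cite: Balaban1985UV3, Thm 1 p.257 + (1)–(5) p.256 + (12)–(37) pp.258–265 + (38)–(41) p.266] -/
structure Hyp (c : Consts) (ε Tε O1 : ℝ) (T : TowerRun) (P : StepPieces T 0) (S12 : B10SectAStatements.FirstStep)
    (A : PolymerActivities) (X : VertexGeometry) (P34 : TermSizes X) (D : DomainSeq) : Prop where
  params : ParamsPrinted c ε Tε
  scaling : ∀ k, T.g k = gRun c.g c.L ε k ∧ T.sites k = sitesRun c.L ε Tε k
  terminal : c.L ^ T.K * ε = c.ε₀
  step0 : Step0Printed T
  noInt0 : NoInteraction0 T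
  rm0 : T.Rm 0 = 0
  spec : SpecOK T
  thm1 : Bounds5 T.toRunData O1
  g0_le_one : T.g 0 ≤ 1
  eq12 : S12.g₀ = T.g 0 ∧ S12.L = c.L ∧ S12.b₀ = c.b₀ ∧ S12.p₀ = c.p₀ ∧ B10SectAStatements.Eq12 S12
  bound22 : Bound55 P
  bound22Lower : Bound55Lower P
  rem_eq : P.rem = ε ^ ((3 : ℝ) + c.κ₀) * T.sites 0
  cumulant24 : Cumulant58 P 0 c.C₂₄
  cumulant37 : CumulantLower P c.C₃₇
  bound25 : Bound25Printed A (T.g 0) c.κ c.C₂₅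
  shape34 : Shape43 X P34 c.κ₁ c.M₁ 1 (c.C₃₄ * T.g 0)
  degree34 : Degree264Printed X P34
  repr33 : Repr33_60 P c.C₃₃
  vacuum265 : VacuumWhole P c.Cv c.Cv'
  norm35 : Norm35 P c.C₃₅
  decomp265 : Decomp35_61 P c.Cd
  starCount : StarCount P c.c₁
  noOld0 : ∀ (h : T.Hist (0 + 1)) (U : T.Cfg (0 + 1)), P.Pold h U = 0 ∧ P.PoldIn h U = 0
  pint36 : PintSucc P
  estep36 : Estep62 P
  zterm36 : ZtermSucc P (c.Cv * T.g 0 + c.C₃₅ + (|P.logσ₀| + P.dg * Real.log (T.g 0)⁻¹) * c.c₁)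
  rm36 : RmSucc P (max c.C₂₄ c.C₃₇ + c.C₃₃ + c.Cv' + c.Cd)
  nested38 : Nested38 D
  sep39 : Sep39 D
  collar39 : ∀ j, D.collar j = c.R₁ * rFun c.r₀ (T.g j) * c.M₁
  rule266 : Rule268 D

/-! ## §4  Bookkeeping a consumer wants (kernel-checked; no content of the series) -/

/-- Monotonicity of (5) in its constant over the carrier of record (χ ≥ 0, |T₁^{(k)}| ≥ 0): a larger O(1) is a weaker pair of
bounds.  Elementary. [cite: Balaban1985UV3, (5) p.256 (bookkeeping)] -/
theorem bounds5_mono (T : TowerRun) {O1 O1' : ℝ} (hle : O1 ≤ O1') (h : Bounds5 T.toRunData O1) :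
    Bounds5 T.toRunData O1' := by
  intro k hk U
  obtain ⟨h1, h2⟩ := h k hk U
  have hs : O1 * T.sites k ≤ O1' * T.sites k := mul_le_mul_of_nonneg_right hle (T.sites_nonneg k)
  constructor
  · refine le_trans (mul_le_mul_of_nonneg_left (Real.exp_le_exp.mpr ?_) (T.χ_nonneg k U)) h1
    linarith
  · exact h2.trans (Real.exp_le_exp.mpr hs)

/-- p. 271 [17] «E_{k+1} = E_k − E^{(k)}» on the carrier (`E_k = Σ_{j=k}^{K−1}E^{(j)}`, (64) p. 273, `TowerRun.Ecst_eq`;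
profile form `B10.Ek_succ`), for k < K.  Elementary telescoping. [cite: Balaban1985UV3, (36) p.265 + (62) p.271 (bookkeeping)] -/
theorem Ecst_succ (T : TowerRun) {k : ℕ} (hk : k < T.K) : T.Ecst (k + 1) = T.Ecst k - T.Estep k := by
  rw [T.Ecst_eq, T.Ecst_eq, Finset.sum_eq_sum_Ico_succ_bot hk]
  ring

/-- **(36) p. 265 (p0011.txt:L20)** *«E₁ = E − E^{(0)}»* — on the carrier, for a run of depth K ≥ 1 (E = E₀ = `T.Ecst 0`,
E^{(0)} = `T.Estep 0`, whose printed value is the slot `Hyp.estep36`). [cite: Balaban1985UV3, (36) p.265] -/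
theorem E1_eq (T : TowerRun) (hK : 1 ≤ T.K) : T.Ecst 1 = T.Ecst 0 - T.Estep 0 :=
  Ecst_succ T hK

namespace Hyp

variable {c : Consts} {ε Tε O1 : ℝ} {T : TowerRun} {P : StepPieces T 0} {S12 : B10SectAStatements.FirstStep}
  {A : PolymerActivities} {X : VertexGeometry} {P34 : TermSizes X} {D : DomainSeq}

/-- p. 256: `g_k = g(L^kε)^{1/2}` (projection). [cite: Balaban1985UV3, (5) p.256 (bookkeeping)] -/
theorem g_eq (h : Hyp c ε Tε O1 T P S12 A X P34 D) (k : ℕ) : T.g k = gRun c.g c.L ε k := (h.scaling k).1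

/-- p. 256: `|T₁^{(k)}| = (L^kε)^{−3}|T_ε|` (projection). [cite: Balaban1985UV3, (5) p.256 (bookkeeping)] -/
theorem sites_eq (h : Hyp c ε Tε O1 T P S12 A X P34 D) (k : ℕ) : T.sites k = sitesRun c.L ε Tε k := (h.scaling k).2

/-- `0 < g_k` along the run. [cite: Balaban1985UV3, (5) p.256 (bookkeeping)] -/
theorem g_pos (h : Hyp c ε Tε O1 T P S12 A X P34 D) (k : ℕ) : 0 < T.g k := by
  rw [h.g_eq k]; exact h.params.gRun_pos k

/-- `0 < g₀ ≤ 1` — what the first-step bookkeeping uses of «for g₀ sufficiently small». [cite: Balaban1985UV3, p.259 (bookkeeping)] -/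
theorem g0_window (h : Hyp c ε Tε O1 T P S12 A X P34 D) : 0 < T.g 0 ∧ T.g 0 ≤ 1 := ⟨h.g_pos 0, h.g0_le_one⟩

/-- p. 256 «L^Kε = ε₀» with L > 1: every scale of the run is below the terminal one, `L^kε ≤ ε₀` for k ≤ K. [cite: Balaban1985UV3, p.256 (bookkeeping)] -/
theorem scale_le_terminal (h : Hyp c ε Tε O1 T P S12 A X P34 D) {k : ℕ} (hk : k ≤ T.K) : c.L ^ k * ε ≤ c.ε₀ := by
  rw [← h.terminal]
  exact mul_le_mul_of_nonneg_right (pow_le_pow_right₀ h.params.one_lt_L.le hk) h.params.ε_pos.le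

/-- The couplings of one run are bounded above by `g·ε₀^{1/2}` («g_k = g(L^kε)^{1/2}», «L^Kε = ε₀»): the "bounded set" of
p. 257 l. 1 for one model. [cite: Balaban1985UV3, p.256–257 (bookkeeping)] -/
theorem g_le_top (h : Hyp c ε Tε O1 T P S12 A X P34 D) {k : ℕ} (hk : k ≤ T.K) : T.g k ≤ c.g * Real.sqrt c.ε₀ := by
  rw [h.g_eq k]
  unfold B10.gRun
  exact mul_le_mul_of_nonneg_left (Real.sqrt_le_sqrt (h.scale_le_terminal hk)) h.params.g_pos.le

/-- (5) at one step k ≤ K (projection of the Theorem-1 slot). [cite: Balaban1985UV3, (5) p.256 (bookkeeping)] -/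
theorem bounds5At (h : Hyp c ε Tε O1 T P S12 A X P34 D) {k : ℕ} (hk : k ≤ T.K) : Bounds5At T.toRunData O1 k :=
  h.thm1 k hk

/-- The variational statement (12) at this run (projection). [cite: Balaban1985UV3, (12) pp.258–259 (bookkeeping)] -/
theorem eq12_holds (h : Hyp c ε Tε O1 T P S12 A X P34 D) : B10SectAStatements.Eq12 S12 := h.eq12.2.2.2.2

/-- (12)'s regularity parameter is this run's `ε₁ = 2L²g₀p(g₀)` (p. 258). [cite: Balaban1985UV3, (12) p.258 (bookkeeping)] -/
theorem eq12_eps1 (h : Hyp c ε Tε O1 T P S12 A X P34 D) :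
    S12.eps1 = 2 * c.L ^ 2 * T.g 0 * pFun c.b₀ c.p₀ (T.g 0) := by
  obtain ⟨hg, hL, hb, hp, -⟩ := h.eq12
  unfold B10SectAStatements.FirstStep.eps1
  rw [hg, hL, hb, hp]

/-- At the first step there are no previous-scale terms, so the p. 272 "old terms outside" leaf holds with constant 0.
[cite: Balaban1985UV3, (22) p.261 (bookkeeping)] -/
theorem oldOutside0 (h : Hyp c ε Tε O1 T P S12 A X P34 D) : OldOutside P 0 := by
  intro hh U
  obtain ⟨h1, h2⟩ := h.noOld0 hh U
  simp [h1, h2]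

/-- **The tree's one-step leaf bundle at k = 0, assembled from the slots** (`B10SectAGathering.StepLeaves T 0`: pieces `P`,
constants `Cz = 0, C₁ = C₂₄, C₁' = C₃₇, C₂ = C₃₃, Cv, C₃ = Cv', C₄ = Cd, C₅ = C₃₅, c₁, C₆ = 0`). [cite: Balaban1985UV3, Sect. A pp.261–265 (bookkeeping)] -/
def stepLeaves (h : Hyp c ε Tε O1 T P S12 A X P34 D) : StepLeaves T 0 where
  P := P
  Cz := 0
  C₁ := c.C₂₄
  C₁' := c.C₃₇
  C₂ := c.C₃₃
  Cv := c.Cv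
  C₃ := c.Cv'
  C₄ := c.Cd
  C₅ := c.C₃₅
  c₁ := c.c₁
  C₆ := 0
  bound55 := h.bound22
  bound55Lower := h.bound22Lower
  cumulant58 := h.cumulant24
  cumulantLower := h.cumulant37
  repr33_60 := h.repr33
  vacuumWhole := h.vacuum265
  decomp35_61 := h.decomp265
  norm35 := h.norm35
  starCount := h.starCount
  oldOutside := h.oldOutside0
  pintSucc := h.pint36
  estep62 := h.estep36
  ztermSucc := by
    have e : (0 + c.Cv) * T.g 0 + c.C₃₅ + 0 + (|P.logσ₀| + P.dg * Real.log (T.g 0)⁻¹) * c.c₁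
        = c.Cv * T.g 0 + c.C₃₅ + (|P.logσ₀| + P.dg * Real.log (T.g 0)⁻¹) * c.c₁ := by ring
    rw [e]
    exact h.zterm36
  rmSucc := h.rm36

/-- **(36)–(37) DELIVERED**: the Sect. A slots give the tree's statement-level row `B10.FirstStep36_37Printed T` = «(Tρ₀)(V) =
ρ₁(V) ≤ …» (36) ∧ «ρ₁(V) ≥ …» (37), through the tree's own resolution `B10SectAGathering.firstStep36_37_of_leaves` (p. 265:
«Gathering together the inequalities and transformations we obtain finally (36)»).  Re-derived bookkeeping. [cite: Balaban1985UV3, (36)–(37) p.265] -/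
theorem firstStep36_37 (h : Hyp c ε Tε O1 T P S12 A X P34 D) : FirstStep36_37Printed T :=
  B10SectAGathering.firstStep36_37_of_leaves T h.step0 (h.g_pos 0) h.g0_le_one (fun _ => h.stepLeaves)

/-- p. 265 [11] (p0011.txt:L21): *«This inequality is the basis of our inductive assumption in the next section.»* — the
inductive assumption (41) and its lower companion (47) HOLD at k = 1 for a run of depth K ≥ 1. [cite: Balaban1985UV3, (36)–(37) p.265 + (41) p.266] -/
theorem ineq41_47_one (h : Hyp c ε Tε O1 T P S12 A X P34 D) (hK : 1 ≤ T.K) : Ineq41 T 1 ∧ Ineq47 T 1 :=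
  h.firstStep36_37 hK

/-- … and therefore the carrier's abstract «ρ₁ satisfies (41), (47)» (Theorem 2's predicate at k = 1) through the binding
`spec`. [cite: Balaban1985UV3, (41) p.266 (bookkeeping)] -/
theorem ineq41_47_spec_one (h : Hyp c ε Tε O1 T P S12 A X P34 D) (hK : 1 ≤ T.K) : T.Ineq41_47 1 :=
  (h.spec 1).mpr (h.ineq41_47_one hK)

/-- (1) p. 256 read on the carrier: (41) ∧ (47) at k = 0, i.e. Theorem 2's predicate at k = 0. [cite: Balaban1985UV3, (1) p.256 (bookkeeping)] -/
theorem ineq41_47_spec_zero (h : Hyp c ε Tε O1 T P S12 A X P34 D) : T.Ineq41_47 0 := (h.spec 0).mpr h.step0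

/-- (36) p. 265: `E^{(0)} = log σ₀|T₁*| + d(𝔤) log g₀|T₁*| + log Z^{(0)}(T₁, 1) + Σ_X𝒫′₁(g₀, X, 1)` on the carrier (projection of
`estep36`). [cite: Balaban1985UV3, (36) p.265 (bookkeeping)] -/
theorem estep0_eq (h : Hyp c ε Tε O1 T P S12 A X P34 D) :
    T.Estep 0 = (P.logσ₀ + P.dg * Real.log (T.g 0)) * P.starT + P.logZT + P.PprT := h.estep36

/-- Sect. B (38): the large-field regions `Z_j = Ω_{j+1}ᶜ` GROW along the run (`B10LargeField.Z_mono`). [cite: Balaban1985UV3, (38) p.266 (bookkeeping)] -/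
theorem Z_mono (h : Hyp c ε Tε O1 T P S12 A X P34 D) (j : ℕ) :
    B10LargeField.Z D j ⊆ B10LargeField.Z D (j + 1) :=
  B10LargeField.Z_mono D h.nested38 j

/-- (39) with the rule of p. 266: a point of Ω_{j+1} is farther than the collar `R(g_j)M₁ = R₁r(g_j)M₁` from every large-field
point of the j-th decomposition (projection of `rule266` with `collar39`). [cite: Balaban1985UV3, (39) p.266 (bookkeeping)] -/
theorem collar_lt_of_largeField (h : Hyp c ε Tε O1 T P S12 A X P34 D) {j : ℕ} {x y : D.Pt} (hy : y ∈ D.Ω (j + 1))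
    (hx : x ∈ D.P j) : c.R₁ * rFun c.r₀ (T.g j) * c.M₁ < D.bdist j x y := by
  rw [← h.collar39 j]
  exact h.rule266 j y hy x (Or.inl hx)

/-- (34) + p. 264: at this run every non-zero coefficient `𝒫₁(g₀, Y)` has between two and six loop variables. [cite: Balaban1985UV3, (34) p.264 (bookkeeping)] -/
theorem degree_window (h : Hyp c ε Tε O1 T P S12 A X P34 D) (y : X.Site) (n : ℕ) (cs : Fin n → X.Bond)
    (hP : P34 y n cs ≠ 0) : 2 ≤ n ∧ n ≤ 6 :=
  degree_window_of_shape34 h.shape34 h.degree34 y n cs hP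

end Hyp

/-! ### Theorem 1 at the family level from the per-run slots -/

section Family

variable {I : Type} {c : Consts} {ε Tε : I → ℝ} {T : I → TowerRun} {P : ∀ i, StepPieces (T i) 0}
  {S12 : I → B10SectAStatements.FirstStep} {A : I → PolymerActivities} {X : I → VertexGeometry}
  {P34 : ∀ i, TermSizes (X i)} {D : I → DomainSeq}

/-- **Theorem 1 in its verbatim typing `B10.Thm1Printed`** from the bundle at every run of a family WITH ONE COMMON (5)-constant
`O1` — print's «the constant O(1) is independent of ε, k» (p. 257 l. 1).  Re-derived bookkeeping (immediate). [cite: Balaban1985UV3, Thm 1 p.257] -/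
theorem thm1Printed_of_forall {O1 : ℝ}
    (h : ∀ i, Hyp c (ε i) (Tε i) O1 (T i) (P i) (S12 i) (A i) (X i) (P34 i) (D i)) :
    Thm1Printed (fun i => (T i).toRunData) :=
  fun _ _ => ⟨O1, fun i _ => (h i).thm1⟩

/-- The uniformity clause made explicit: per-run constants `O1 i` that are BOUNDED over the family already give
`B10.Thm1Printed` (with the bound as the common constant, by `bounds5_mono`). [cite: Balaban1985UV3, Thm 1 p.257 (bookkeeping)] -/
theorem thm1Printed_of_bounded {O1 : I → ℝ} (M : ℝ) (hM : ∀ i, O1 i ≤ M)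
    (h : ∀ i, Hyp c (ε i) (Tε i) (O1 i) (T i) (P i) (S12 i) (A i) (X i) (P34 i) (D i)) :
    Thm1Printed (fun i => (T i).toRunData) :=
  fun _ _ => ⟨M, fun i _ => bounds5_mono (T i) (hM i) (h i).thm1⟩

/-- **Theorem 1 in the cell's audit reading `B10.Thm1PrintedCompact`** (one constant per compact coupling window; GAPS G-B10-01)
from the bundle with a common constant — a fortiori. [cite: Balaban1985UV3, Thm 1 p.257 (bookkeeping)] -/
theorem thm1Compact_of_forall {O1 : ℝ}
    (h : ∀ i, Hyp c (ε i) (Tε i) O1 (T i) (P i) (S12 i) (A i) (X i) (P34 i) (D i)) :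
    Thm1PrintedCompact (fun i => (T i).toRunData) :=
  fun _ _ _ _ => ⟨O1, fun i k hk _ _ => (h i).thm1 k hk⟩

/-- Theorem 2's predicate at the first two levels for every run of the family (from (1) and the delivered (36)–(37)).
[cite: Balaban1985UV3, (36)–(37) p.265 (bookkeeping)] -/
theorem ineq41_47_le_one_of_forall {O1 : I → ℝ}
    (h : ∀ i, Hyp c (ε i) (Tε i) (O1 i) (T i) (P i) (S12 i) (A i) (X i) (P34 i) (D i)) (i : I) {k : ℕ} (hk1 : k ≤ 1)
    (hkK : k ≤ (T i).K) : (T i).Ineq41_47 k := by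
  rcases Nat.le_one_iff_eq_zero_or_eq_one.mp hk1 with rfl | rfl
  · exact (h i).ineq41_47_spec_zero
  · exact (h i).ineq41_47_spec_one hkK

end Family

/-! ### Non-degeneracy: the bundle is refutable -/

section NonDegeneracy

variable {c : Consts} {ε Tε O1 : ℝ} {T : TowerRun} {P : StepPieces T 0} {S12 : B10SectAStatements.FirstStep}
  {A : PolymerActivities} {X : VertexGeometry} {P34 : TermSizes X} {D : DomainSeq}

/-- A density value above the upper bound of (5) at some step refutes the bundle. [cite: Balaban1985UV3, (5) p.256 (bookkeeping)] -/
theorem not_hyp_of_rho_gt {k : ℕ} (hk : k ≤ T.K) {U : T.Cfg k} (hU : Real.exp (O1 * T.sites k) < T.ρ k U) :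
    ¬ Hyp c ε Tε O1 T P S12 A X P34 D :=
  fun h => (not_le.mpr hU) (h.thm1 k hk U).2

/-- An exponent `p₀ ≤ 2` refutes the bundle (print: «p₀ > 2»). [cite: Balaban1985UV3, p.257 (bookkeeping)] -/
theorem not_hyp_of_p₀_le_two (hp : c.p₀ ≤ 2) : ¬ Hyp c ε Tε O1 T P S12 A X P34 D :=
  fun h => (not_lt.mpr hp) h.params.two_lt_p₀

/-- A first-step coefficient with seven loop variables refutes the bundle (p. 264: «at most the sixth order»).
[cite: Balaban1985UV3, p.264 (bookkeeping)] -/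
theorem not_hyp_of_degree_seven {y : X.Site} {cs : Fin 7 → X.Bond} (hP : P34 y 7 cs ≠ 0) :
    ¬ Hyp c ε Tε O1 T P S12 A X P34 D :=
  fun h => absurd (h.degree34 y 7 cs hP) (by norm_num)

end NonDegeneracy

/-! ## §5  NON-VACUITY: the bundle holds on the tree's trivial run (`B10Assembly.trivRun K`, every depth K)
(a consistency check of the TYPING — all slots are jointly satisfiable as typed — nothing about gauge theory) -/

section Witness

/-- Family constants of the witness: g = 1, L = 2, ε₀ = 1, M₁ = b₀ = R₁ = r₀ = 1, p₀ = 3, κ₀ = ¼, κ = 7, κ₁ = 1, all O(·)'s 0. [folklore] -/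
def trivConsts : Consts where
  g := 1
  L := 2
  ε₀ := 1
  M₁ := 1
  b₀ := 1
  p₀ := 3
  R₁ := 1
  r₀ := 1
  κ₀ := 1 / 4
  κ := 7
  C₂₅ := 0
  κ₁ := 1
  C₃₄ := 0
  C₂₄ := 0
  C₃₇ := 0
  C₃₃ := 0
  Cv := 0
  Cv' := 0
  C₃₅ := 0
  Cd := 0
  c₁ := 0

/-- The one-point variational problem (every predicate true, all norms 0). [folklore] -/
def trivVarProblem : B11.VarProblem where
  Cfg := Unit
  Bdry := Unit
  Cube := Unit
  scale := fun _ => 0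
  sizeM := fun _ => 0
  eta := 1
  L := 2
  InU := fun _ _ => True
  InB := fun _ _ => True
  Reg7 := fun _ _ => True
  OnMinimalOrbit := fun _ _ _ => True
  UniqueCriticalOrbit := fun _ _ _ => True
  Gauged := fun _ _ => True
  normA := fun _ _ => 0
  normGradA := fun _ _ => 0
  holderA := fun _ _ _ => 0
  normLapA := fun _ _ => 0

/-- The trivial first-step data over it (no plaquettes in Ω₁; the run's `g₀`; L = 2, b₀ = 1, p₀ = 3). [folklore] -/
def trivFirstStep (K : ℕ) : B10SectAStatements.FirstStep where
  P := trivVarProblem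
  Axial := fun _ => True
  IsCritical := fun _ _ => True
  Regular := fun _ => True
  InRegion := fun _ _ => True
  Plaq := Unit
  omega1 := ∅
  dev := fun _ _ => 0
  g₀ := (B10Assembly.trivRun K).g 0
  b₀ := 1
  p₀ := 3
  L := 2
  a₁ := 0
  B₃ := 0

/-- The trivial localization expansion (one polymer, activity 0). [folklore] -/
def trivPoly : PolymerActivities where
  Poly := Unit
  Cfg := Unit
  ℒ := fun _ => 0
  act := fun _ _ => 0

/-- The trivial loop-variable geometry (one site, one bond, all lengths 0). [folklore] -/
def trivGeom : VertexGeometry where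
  Bond := Unit
  Site := Unit
  treeLen := fun _ _ => 0
  cminus := fun _ => ()
  dist := fun _ _ => 0

/-- The zero coefficient family over it. [folklore] -/
def trivSizes : TermSizes trivGeom := fun _ _ _ => 0

/-- The trivial domain sequence (every Ω_j the whole lattice, no large fields, collar `R₁r(g_j)M₁`). [folklore] -/
def trivDom (K : ℕ) : DomainSeq where
  Pt := Unit
  Ω := fun _ => Set.univ
  P := fun _ => ∅
  bdist := fun _ _ _ => 0
  bdist_self := fun _ _ => rfl
  collar := fun j => trivConsts.R₁ * rFun trivConsts.r₀ ((B10Assembly.trivRun K).g j) * trivConsts.M₁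

/-- (12) holds for the one-point problem (its conclusion holds outright) — typing check. [cite: Balaban1985UV3, (12) pp.258–259 (typing check)] -/
theorem eq12_triv (K : ℕ) : B10SectAStatements.Eq12 (trivFirstStep K) := by
  intro _ W _
  refine ⟨⟨(), ⟨trivial, trivial, trivial, trivial⟩, fun U _ _ _ _ => rfl⟩, fun _ _ => trivial, ?_⟩
  intro U₁ _ _ _ _ p hp
  exact absurd hp (Set.notMem_empty p)

/-- **THE BUNDLE IS INHABITED (every depth K)**: on the tree's trivial run `B10Assembly.trivRun K` (ρ_k ≡ χ_k ≡ 1, all actions,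
interactions, counterterms, Z-terms and remainders 0, spacing ε = 2^{−K}, |T_ε| = 1) with its step-0 pieces
`B10Assembly.trivPieces K 0`, the data above and `O1 = 0`, every slot holds — so the 35 named hypotheses are jointly satisfiable
AS TYPED and the theorems of §4 are not vacuous.  A consistency check of the typing, not a statement about Yang–Mills. [cite: Balaban1985UV3, pp.256–266 (typing check: non-vacuity)] -/
theorem hyp_trivRun (K : ℕ) :
    Hyp trivConsts (((2 : ℝ) ^ K)⁻¹) 1 0 (B10Assembly.trivRun K) (B10Assembly.trivPieces K 0) (trivFirstStep K) trivPoly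
      trivGeom trivSizes (trivDom K) where
  params :=
    { g_pos := by norm_num [trivConsts]
      one_lt_L := by norm_num [trivConsts]
      ε_pos := by positivity
      Tε_nonneg := zero_le_one
      ε₀_pos := by norm_num [trivConsts]
      M₁_pos := by norm_num [trivConsts]
      b₀_pos := by norm_num [trivConsts]
      two_lt_p₀ := by norm_num [trivConsts]
      R₁_pos := by norm_num [trivConsts]
      κ₀_pos := by norm_num [trivConsts]
      κ_pos := by norm_num [trivConsts]
      κ₁_eq := by norm_num [trivConsts] }
  scaling := fun _ => ⟨rfl, rfl⟩
  terminal := by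
    show (2 : ℝ) ^ K * ((2 : ℝ) ^ K)⁻¹ = 1
    exact mul_inv_cancel₀ (by positivity)
  step0 := (B10Assembly.trivLeafSystem K).step0
  noInt0 := (B10Assembly.trivLeafSystem K).noInt0
  rm0 := rfl
  spec := (B10Assembly.trivLeafSystem K).spec
  thm1 := fun k _ U => by simp [B10Assembly.trivRun]
  g0_le_one := (B10Assembly.trivLeafSystem K).g_le_one 0 (Nat.zero_le _)
  eq12 := ⟨rfl, rfl, rfl, rfl, eq12_triv K⟩
  bound22 := (B10Assembly.trivLeaves K 0).bound55
  bound22Lower := (B10Assembly.trivLeaves K 0).bound55Lower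
  rem_eq := by
    show ((2 : ℝ) ^ 0 * ((2 : ℝ) ^ K)⁻¹) ^ ((3 : ℝ) + 1 / 4) * sitesRun 2 (((2 : ℝ) ^ K)⁻¹) 1 0
      = (((2 : ℝ) ^ K)⁻¹) ^ ((3 : ℝ) + 1 / 4) * sitesRun 2 (((2 : ℝ) ^ K)⁻¹) 1 0
    rw [pow_zero, one_mul]
  cumulant24 := (B10Assembly.trivLeaves K 0).cumulant58
  cumulant37 := (B10Assembly.trivLeaves K 0).cumulantLower
  bound25 := fun _ _ => by simp [trivPoly, trivConsts]
  shape34 := ⟨fun _ _ _ hP => absurd rfl hP, fun _ _ _ => by simp [trivSizes, trivConsts]⟩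
  degree34 := fun _ _ _ hP => absurd rfl hP
  repr33 := (B10Assembly.trivLeaves K 0).repr33_60
  vacuum265 := (B10Assembly.trivLeaves K 0).vacuumWhole
  norm35 := (B10Assembly.trivLeaves K 0).norm35
  decomp265 := (B10Assembly.trivLeaves K 0).decomp35_61
  starCount := (B10Assembly.trivLeaves K 0).starCount
  noOld0 := fun _ _ => ⟨rfl, rfl⟩
  pint36 := (B10Assembly.trivLeaves K 0).pintSucc
  estep36 := (B10Assembly.trivLeaves K 0).estep62
  zterm36 := fun _ => by simp [B10Assembly.trivRun, B10Assembly.trivPieces]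
  rm36 := by simp [RmSucc, B10Assembly.trivRun, B10Assembly.trivPieces, trivConsts]
  nested38 := fun _ => subset_rfl
  sep39 := fun _ x _ hx _ => absurd (Set.mem_univ x) hx
  collar39 := fun _ => rfl
  rule266 := fun _ _ _ x hx => by
    rcases hx with hx | hx
    · exact absurd hx (Set.notMem_empty x)
    · exact absurd (Set.mem_univ x) hx

/-- … hence Theorem 1 in BOTH family-level typings holds for the one-member trivial family (the §4 theorems applied to the
witness) — again a typing check only. [cite: Balaban1985UV3, Thm 1 p.257 (typing check)] -/
theorem trivRun_thm1 (K : ℕ) :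
    Thm1Printed (fun _ : Unit => (B10Assembly.trivRun K).toRunData)
      ∧ Thm1PrintedCompact (fun _ : Unit => (B10Assembly.trivRun K).toRunData) :=
  ⟨thm1Printed_of_forall (fun _ => hyp_trivRun K), thm1Compact_of_forall (fun _ => hyp_trivRun K)⟩

end Witness

end Literature.MathematicalPhysics.QuantumFieldTheory.Balaban1983to89.B10Carve31Thm1SectsABHyp

end
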